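import Literature.NumberTheory.EllipticCurves.BinaryQuarticTwoCoveringsLocalConic
import Literature.NumberTheory.EllipticCurves.BinaryQuarticTwoCoveringsSelmerMap
import Literature.NumberTheory.QuadraticForms.MeyerProofs
import HarnessLib

/-!
# Two-coverings attached to binary quartic forms, X: the conic has a rational point

Topic `Literature/NumberTheory/EllipticCurves`. Tenth file of the theory proving the named fact
`Literature.NumberTheory.EllipticCurves.bhargavaShankar_card_selmerTwo_eq_kEquivClassCount`.
For a cocycle `φ` whose class lies in the `2`-Selmer group, the rational conic `q_φ` of file VIII
represents zero over `ℚ`: it represents zero over every completion (file IX, supplied here with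
rational points of `E_{A,B}` over `ℚ_p` — abscissae `p^{-2m}` and Hensel — and over `ℝ` — large
abscissae), hence over `ℚ` by the **Hasse–Minkowski theorem** (the tree's `hasseMinkowski_holds`,
Serre, *Cours d'arithmétique*, Ch. IV Thm. 8), as in Birch–Swinnerton-Dyer 1963, Lemma 1 and
Cremona 2001 §5 ("the Hasse principle for conics").

* `§1` transport of `RepresentsZero` along ring isomorphisms;
* `§2` real points of `E_{A,B}`; `§3` `p`-adic points of `E_{A,B}`;
* `§4` `exists_rat_isotropic`: a nonzero rational isotropic vector of `q_φ`.

## References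

* B. J. Birch, H. P. F. Swinnerton-Dyer, *Notes on elliptic curves. I*, J. reine angew. Math. 212
  (1963), Lemma 1. [BirchSwinnertonDyer1963]
* J. E. Cremona, *Classical invariants and 2-descent on elliptic curves*, J. Symbolic Comput. 31
  (2001), §5. [Cremona2001]
* J.-P. Serre, *A Course in Arithmetic*, Ch. IV §3.2 Thm. 8. [Serre1973]
-/

noncomputable section

open scoped Classical

universe u

namespace Literature.NumberTheory.EllipticCurves

namespace TwoCovering

open BinaryQuartic WeierstrassCurve WeierstrassCurve.Affine GaloisRepresentations
open Literature.NumberTheory.QuadraticForms NumberField IsDedekindDomain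

/-! ## §1 Transport of isotropy along ring isomorphisms -/

section Transport

/-- `RepresentsZero` for a rational matrix is independent of the model of the completion: it
transports along a ring isomorphism `F ≃ F′` (ring homomorphisms `ℚ → F′` are unique). [folklore] -/
theorem representsZero_map_of_ringEquiv {F F' : Type*} [Field F] [Field F'] (e : F ≃+* F') {n : ℕ}
    (A : Matrix (Fin n) (Fin n) ℚ) (φ : ℚ →+* F) (ψ : ℚ →+* F') (h : RepresentsZero (A.map φ)) :
    RepresentsZero (A.map ψ) := by
  have hcomp : (e : F →+* F').comp φ = ψ := Subsingleton.elim _ _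
  obtain ⟨v, hv0, hv⟩ := h
  refine ⟨e ∘ v, fun h0 ↦ hv0 (funext fun i ↦ e.injective ?_), ?_⟩
  · have := congrFun h0 i
    simp only [Function.comp_apply, Pi.zero_apply] at this
    rw [this, Pi.zero_apply, map_zero]
  · have hmat : A.map ψ = (A.map φ).map (e : F →+* F') := by
      rw [Matrix.map_map, ← hcomp]; rfl
    rw [hmat, show (e ∘ v : Fin n → F') = (e : F →+* F') ∘ v from rfl, toBilin'_map_apply, hv, map_zero]

end Transport

/-! ## §2 Real points of `E_{A,B}` -/

section RealPoints

/-- For `x ≥ |A| + |B| + 1`, `x³ + Ax + B > 0`. [folklore] -/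
theorem cubic_pos_of_large (A B x : ℝ) (hx : |A| + |B| + 1 ≤ x) : 0 < x ^ 3 + A * x + B := by
  have hx1 : 1 ≤ x := by linarith [abs_nonneg A, abs_nonneg B]
  have hx0 : 0 ≤ x := by linarith
  have hA : -|A| * x ≤ A * x := by nlinarith [neg_abs_le A, abs_nonneg A]
  have hB : -|B| ≤ B := neg_abs_le B
  have hx2 : x ≤ x ^ 2 := by nlinarith
  nlinarith [abs_nonneg A, abs_nonneg B]

/-- **Five real points** of `y² = x³ + Ax + B` with distinct abscissae and `y ≠ 0`, over a field
`F ≃ ℝ` (a real completion), in the format of file IX. [folklore] -/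
theorem exists_points_of_ringEquiv_real {F : Type*} [Field F] [Algebra ℚ F] (e : F ≃+* ℝ) (AB : ℤ × ℤ) :
    ∃ xs : Fin 5 → F, Function.Injective xs ∧ ∀ i, ∃ y : F, y ≠ 0 ∧
      y ^ 2 = xs i ^ 3 + algebraMap ℚ F (AB.1 : ℚ) * xs i + algebraMap ℚ F (AB.2 : ℚ) := by
  have hcomp : ∀ q : ℚ, e.symm (q : ℝ) = algebraMap ℚ F q := fun q ↦ by
    have : (e.symm : ℝ →+* F).comp (Rat.castHom ℝ) = algebraMap ℚ F := Subsingleton.elim _ _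
    exact RingHom.congr_fun this q
  set M : ℝ := |(AB.1 : ℝ)| + |(AB.2 : ℝ)| + 1 with hM
  refine ⟨fun i ↦ e.symm (M + i), fun i j hij ↦ ?_, fun i ↦ ?_⟩
  · have h := e.symm.injective hij
    exact Fin.ext (by exact_mod_cast (add_left_cancel h : ((i : ℕ) : ℝ) = j))
  · have hpos : 0 < (M + i) ^ 3 + (AB.1 : ℝ) * (M + i) + (AB.2 : ℝ) :=
      cubic_pos_of_large _ _ _ (by rw [hM]; linarith [(i : ℕ).cast_nonneg (α := ℝ)])
    refine ⟨e.symm (Real.sqrt ((M + i) ^ 3 + (AB.1 : ℝ) * (M + i) + (AB.2 : ℝ))), ?_, ?_⟩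
    · rw [map_ne_zero_iff _ e.symm.injective]
      exact (Real.sqrt_pos.mpr hpos).ne'
    · rw [← map_pow, Real.sq_sqrt hpos.le, map_add, map_add, map_mul, map_pow,
        show (AB.1 : ℝ) = ((AB.1 : ℚ) : ℝ) by push_cast; rfl, show (AB.2 : ℝ) = ((AB.2 : ℚ) : ℝ) by push_cast; rfl,
        hcomp, hcomp]

end RealPoints

/-! ## §3 `p`-adic points of `E_{A,B}` -/

section PadicPoints

variable (p : ℕ) [Fact p.Prime]

/-- `‖2‖ ≥ p⁻¹` in `ℤ_p` (equality for `p = 2`, and `‖2‖ = 1` for odd `p`). [folklore] -/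
theorem inv_le_norm_two : (p : ℝ)⁻¹ ≤ ‖(2 : ℤ_[p])‖ := by
  by_cases hp2 : p = 2
  · subst hp2
    have h := PadicInt.norm_p (p := 2)
    rw [show ((2 : ℕ) : ℤ_[2]) = 2 by norm_num] at h
    exact h.symm.le
  · have hnd : ¬ ((p : ℤ) ∣ 2) := by
      intro h
      have h' : (p : ℤ) ∣ (2 : ℕ) := by exact_mod_cast h
      rw [Int.natCast_dvd_natCast] at h'
      have := (Nat.prime_two.eq_one_or_self_of_dvd p h').resolve_left (Fact.out : p.Prime).one_lt.ne'
      exact hp2 this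
    have h1 : ¬ ‖((2 : ℤ) : ℤ_[p])‖ < 1 := fun h ↦ hnd ((PadicInt.norm_int_lt_one_iff_dvd 2).mp h)
    push Not at h1
    rw [show ((2 : ℤ) : ℤ_[p]) = 2 by norm_num] at h1
    have hp1 : (1 : ℝ) ≤ p := by exact_mod_cast (Fact.out : p.Prime).one_lt.le
    exact (inv_le_one_of_one_le₀ hp1).trans h1

/-- **A square root in `ℤ_p`**: `1 + A p^{4m} + B p^{6m}` is a square for `m ≥ 1` (Hensel, through
the tree's `exists_sq_eq_of_norm_sub_lt`). [folklore] -/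
theorem exists_sq_eq_one_add (A B : ℤ) {m : ℕ} (hm : 1 ≤ m) :
    ∃ z : ℤ_[p], z ≠ 0 ∧ z ^ 2 = 1 + (A : ℤ_[p]) * (p : ℤ_[p]) ^ (4 * m) + (B : ℤ_[p]) * (p : ℤ_[p]) ^ (6 * m) := by
  set w : ℤ_[p] := 1 + (A : ℤ_[p]) * (p : ℤ_[p]) ^ (4 * m) + (B : ℤ_[p]) * (p : ℤ_[p]) ^ (6 * m) with hw
  have hp1 : (1 : ℝ) < p := by exact_mod_cast (Fact.out : p.Prime).one_lt
  have hdiff : ‖(1 : ℤ_[p]) ^ 2 - w‖ ≤ (p : ℝ) ^ (-(4 * m : ℕ) : ℤ) := by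
    have : (1 : ℤ_[p]) ^ 2 - w = (p : ℤ_[p]) ^ (4 * m) * (-((A : ℤ_[p]) + (B : ℤ_[p]) * (p : ℤ_[p]) ^ (2 * m))) := by
      rw [hw]; ring
    rw [this, norm_mul, PadicInt.norm_p_pow]
    exact mul_le_of_le_one_right (zpow_nonneg (by positivity) _) (PadicInt.norm_le_one _)
  have hlt : ‖(1 : ℤ_[p]) ^ 2 - w‖ < ‖2 * (1 : ℤ_[p])‖ ^ 2 := by
    rw [mul_one]
    refine hdiff.trans_lt ?_
    have h2 := inv_le_norm_two p
    have hle : ((p : ℝ)⁻¹) ^ 2 ≤ ‖(2 : ℤ_[p])‖ ^ 2 := pow_le_pow_left₀ (by positivity) h2 2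
    refine lt_of_lt_of_le ?_ hle
    rw [inv_pow, ← zpow_natCast, ← zpow_neg]
    exact zpow_lt_zpow_right₀ hp1 (by push_cast; omega)
  obtain ⟨z, hz⟩ := exists_sq_eq_of_norm_sub_lt hlt
  refine ⟨z, fun h0 ↦ ?_, hz⟩
  rw [h0, zero_pow two_ne_zero] at hz
  have h1 : ‖(1 : ℤ_[p]) ^ 2 - w‖ < 1 := by
    refine hdiff.trans_lt (zpow_lt_one_of_neg₀ hp1 ?_)
    push_cast; omega
  rw [← hz, sub_zero, one_pow, norm_one] at h1
  exact lt_irrefl _ h1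

/-- **Five `p`-adic points** of `y² = x³ + Ax + B` with distinct abscissae `p^{-2m}` (`m = 1, …, 5`)
and `y ≠ 0`, over a field `F ≃ ℚ_p` (a finite completion), in the format of file IX. [folklore] -/
theorem exists_points_of_ringEquiv_padic {F : Type*} [Field F] [Algebra ℚ F] (e : ℚ_[p] ≃+* F) (AB : ℤ × ℤ) :
    ∃ xs : Fin 5 → F, Function.Injective xs ∧ ∀ i, ∃ y : F, y ≠ 0 ∧
      y ^ 2 = xs i ^ 3 + algebraMap ℚ F (AB.1 : ℚ) * xs i + algebraMap ℚ F (AB.2 : ℚ) := by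
  have hcomp : ∀ q : ℚ, e (q : ℚ_[p]) = algebraMap ℚ F q := fun q ↦ by
    have : (e : ℚ_[p] →+* F).comp (Rat.castHom ℚ_[p]) = algebraMap ℚ F := Subsingleton.elim _ _
    exact RingHom.congr_fun this q
  have hp0 : (p : ℚ_[p]) ≠ 0 := by exact_mod_cast (Fact.out : p.Prime).ne_zero
  have hp1 : 1 < p := (Fact.out : p.Prime).one_lt
  have hp1' : (1 : ℝ) < p := by exact_mod_cast hp1
  refine ⟨fun i ↦ e (((p : ℚ_[p]) ^ (2 * ((i : ℕ) + 1)))⁻¹), fun i j hij ↦ ?_, fun i ↦ ?_⟩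
  · have h := inv_injective (e.injective hij)
    have hn := congrArg (fun x : ℚ_[p] ↦ ‖x‖) h
    simp only [Padic.norm_p_pow] at hn
    have := zpow_right_injective₀ (by positivity) hp1'.ne' hn
    exact Fin.ext (by push_cast at this; omega)
  · obtain ⟨z, hz0, hz⟩ := exists_sq_eq_one_add p AB.1 AB.2 (m := (i : ℕ) + 1) (by omega)
    set m : ℕ := (i : ℕ) + 1 with hm
    refine ⟨e (((p : ℚ_[p]) ^ (3 * m))⁻¹ * (z : ℚ_[p])), ?_, ?_⟩
    · rw [map_ne_zero_iff _ e.injective]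
      exact mul_ne_zero (inv_ne_zero (pow_ne_zero _ hp0)) (fun h ↦ hz0 (PadicInt.coe_eq_zero.mp h))
    · have hz' : ((z : ℚ_[p])) ^ 2 = 1 + (AB.1 : ℚ_[p]) * (p : ℚ_[p]) ^ (4 * m) + (AB.2 : ℚ_[p]) * (p : ℚ_[p]) ^ (6 * m) := by
        have := congrArg ((↑) : ℤ_[p] → ℚ_[p]) hz
        push_cast at this
        exact this
      rw [← map_pow, ← map_pow, show algebraMap ℚ F (AB.1 : ℚ) = e ((AB.1 : ℚ) : ℚ_[p]) from (hcomp _).symm,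
        show algebraMap ℚ F (AB.2 : ℚ) = e ((AB.2 : ℚ) : ℚ_[p]) from (hcomp _).symm, ← map_mul, ← map_add, ← map_add]
      congr 1
      rw [mul_pow, hz', Rat.cast_intCast, Rat.cast_intCast]
      field_simp
      ring

end PadicPoints

/-! ## §4 The rational point on the conic -/

section Global

open Rat.HeightOneSpectrum

variable {AB : ℤ × ℤ} (hE : 4 * AB.1 ^ 3 + 27 * AB.2 ^ 2 ≠ 0)
  (φ : contOneCocycles (discreteTopRep (Field.absoluteGaloisGroup ℚ) (geomTorsion (shortWeierstrass AB) 2)))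

/-- **The conic of a Selmer class has a rational point** (Birch–Swinnerton-Dyer 1963, Lemma 1;
Cremona 2001, §5, via the Hasse principle for conics): for `[φ] ∈ Sel₂(E_{A,B}/ℚ)`, the
nondegenerate rational ternary form `q_φ` is isotropic over every `ℚ_p` and over `ℝ` (file IX with
`§2`–`§3`), hence over `ℚ` by Hasse–Minkowski (`hasseMinkowski_holds`).
[cite: Cremona2001, §5 (Hasse principle for the conic Q(u,v,w) = 0)] -/
theorem exists_rat_isotropic (hc : oneCocycleClass _ φ ∈ selmerGroup (shortWeierstrass AB) 2) :
    ∃ v : Fin 3 → ℚ, v ≠ 0 ∧ Matrix.toBilin' (conicMat hE φ) v v = 0 := by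
  obtain ⟨hfin, hinf⟩ := (mem_selmerGroup_iff _ 2 _).mp hc
  have hreal : RepresentsZero ((conicMat hE φ).map (Rat.castHom ℝ)) := by
    let w : InfinitePlace ℚ := default
    have e := InfinitePlace.Completion.ringEquivRealOfIsReal (IsTotallyReal.isReal w)
    have h := representsZero_conicMat_local hE φ w.Completion (hinf w) (exists_points_of_ringEquiv_real e AB)
    exact representsZero_map_of_ringEquiv e _ (algebraMap ℚ _) (Rat.castHom ℝ) h
  have hpadic : ∀ (p : ℕ) [Fact p.Prime], RepresentsZero ((conicMat hE φ).map (Rat.castHom ℚ_[p])) := by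
    intro p hp
    let P : Nat.Primes := ⟨p, hp.out⟩
    have e := (Padic.adicCompletionEquiv (R := 𝓞 ℚ) P).toRingEquiv
    have h := representsZero_conicMat_local hE φ (((primesEquiv (R := 𝓞 ℚ)).symm P).adicCompletion ℚ)
      (hfin _) (exists_points_of_ringEquiv_padic p e AB)
    exact representsZero_map_of_ringEquiv e.symm _ (algebraMap ℚ _) (Rat.castHom ℚ_[p]) h
  exact hasseMinkowski_holds (conicMat hE φ) (conicMat_isSymm hE φ) (conicMat_det_ne_zero hE φ) hreal hpadic

end Global

end TwoCovering

end Literature.NumberTheory.EllipticCurves
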